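import Mathlib
import Summits.NavierStokesRegularity.NavierStokesRegularity.Theorems.EulerZoomLiouvillePowerGaugeEulerLiouvilleFadingPowerPast
import HarnessLib

/-!
# Crux E `PowerGaugeEulerLiouville` (stmt-NavierStokesRegularity-19832): NEGATIVE-RATE TAME POWER CLOCKS are trivial
# (line `logtime-breathers`, a bite out of the residue T4 `stub_powerClockRest`)

Route `EulerZoomLiouville` (NavierStokesRegularity), crux E; extra-width seat ns-ezl-w7 g0 on line `logtime-breathers` (crux dir
`Cruxes/PowerGaugeEulerLiouville/Lines/logtime-breathers.md`).  By T1 (clock rigidity, `ClockRigidity.clockRigidity_of_classical_shapePreserving`,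
ns-ezl-w4) a classical shape-preserving member is a log-time breather, steady, or a POWER CLOCK `u(τ, y) = (T₀−τ)^{g−1} W((T₀−τ)^{−g} y)`.
The tree kills the fast clocks `g > ½ − ρ/5` about any `T₀` and the slow clocks `g < 1/(2+ρ)` about the FINAL time `T₀ = 0` by the `A`-gauge
(`PastShape.*`), the finite-energy slow clocks (`PowerClock.ae_eq_zero_of_gauge_of_finiteEnergySlowClock`), and the tame window clocks `0 < g < ½`
(`…PowerClockTameProfile`), whose docstring records the residue «the clocks `g ≤ 0` about `T₀ > 0`» — with ANY profile, even tame: for `T₀ > 0`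
the `A`-gauge arithmetic is consistent (the clock `T₀ − τ` stays away from `0`), and the lead's profile-level levers need the OUTWARD similarity
drift `g > 0`.

For `g < 0` the drift is INWARD and, in physical variables, the velocity envelope `‖u(τ, ·)‖_∞ ≤ B (T₀−τ)^{g−1}` is INTEGRABLE at `τ = −∞`
— exactly the LEAD's Lagrangian mechanism of T2b, in the power-law form of the prequel `…FadingPowerPast`.  THIS FILE: a member of the class
(`0 < ρ ≤ ½`) that is classical on a past sub-slab `(−∞, T₁)` (`T₁ ≤ 0`, `T₁ ≤ T₀`; nothing assumed on `[T₁, 0)`) and there a power clock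
about `T₀` with a NEGATIVE rate `g < 0` and a TAME profile — `‖W‖ ≤ B`, `‖∇W(z)‖ ≤ C (1 + ‖z‖)^{−q}` for some `q > 0` — vanishes a.e.
(`NegRateClock.ae_eq_zero_of_gauge_of_tameNegRateClock`).  Dictionary (on the shrunk sub-slab `(−∞, T₁ − 1)`, where `T₀ − s ≥ 1`):
`‖u(s, y)‖ ≤ B (T₀−s)^{−(1−g)}` with `1 − g > 1`; `∇u(s, y) = (T₀−s)^{−1} ∇W((T₀−s)^{−g} y)` (`NegRateClock.hasFDerivAt_slice`), so the slices are
`C`-Lipschitz and, for `‖y‖ ≥ δ`, `‖∇u(s, y)‖ ≤ C δ^{−q} (T₀−s)^{−(1 − gq)}` with `1 − gq > 1` (`NegRateClock.norm_fderiv_slice_le_of_le_norm`); then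
`FadingPowerPast.ae_eq_zero_of_gauge_of_fadingPowerPast` — here first restated with a REAL gradient bound `‖∇u(s, ·)‖ ≤ K` in place of the
`LipschitzWith ⟨K, _⟩` binder (`FadingPowerPast.ae_eq_zero_of_gauge_of_fadingPowerPast_of_norm_fderiv_le`, the shape a skeleton predicate can quote).
RESIDUE of T4's tame part after this file: the borderline rate `g = 0` (separable members `u = V(y)/(T₀ − τ)`, logarithmically divergent displacement).

WHAT THIS IS NOT: not NS regularity, not the crux E — 19832 is a crux CLASS on the MODEL lattice (E/NS strata); one more classical stratum for
the lead skeleton (LEAD ns-typeII-p2 g11), helper credit only. [folklore; MajdaBertozziCUP2002 §2.5 (2.115)–(2.117), §4.2 (4.46)–(4.47);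
ConstantinIgnatovaVicol2026Putative §3.1 (3.2)–(3.3) (the ansatz with a general exponent); line card `Lines/logtime-breathers.md` T4]
-/

noncomputable section

set_option linter.dupNamespace false

open MeasureTheory Set Filter Topology Metric Function
open scoped NNReal ENNReal ContDiff

namespace Summit.NavierStokesRegularity.NavierStokesRegularity.Theorems.PowerGaugeEulerLiouville

open Literature.Analysis Literature.Analysis.FluidPDE

/-! ### The abstract stratum with a real Lipschitz constant (predicate-friendly corollary of the prequel) -/

namespace FadingPowerPast

variable {u : ℝ → EuclideanSpace ℝ (Fin 3) → EuclideanSpace ℝ (Fin 3)} {p : ℝ → EuclideanSpace ℝ (Fin 3) → ℝ}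
  {T₁ T₀ M m K : ℝ}

/-- **MEMBERS WITH AN ALGEBRAICALLY FADING TAME PAST ARE TRIVIAL, real-constant form**: as
`FadingPowerPast.ae_eq_zero_of_gauge_of_fadingPowerPast`, with the uniform Lipschitz hypothesis spelled as a gradient bound
`‖∇u(s, y)‖ ≤ K` (`K : ℝ`) instead of `LipschitzWith ⟨K, _⟩ (u s)` — the shape a skeleton predicate can quote verbatim. [folklore] -/
theorem ae_eq_zero_of_gauge_of_fadingPowerPast_of_norm_fderiv_le {ρ : ℝ} (hρ : 0 < ρ) (hρh : ρ ≤ 1 / 2)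
    {H : ℝ → EuclideanSpace ℝ (Fin 3) → EuclideanSpace ℝ (Fin 3) →L[ℝ] EuclideanSpace ℝ (Fin 3)} {c₀ : ℝ≥0}
    (hsw : IsSuitableWeakSolutionOn (slab (EuclideanSpace ℝ (Fin 3)) (Iio 0) isOpen_Iio) 0 0 u p)
    (hH : HasWeakSpatialGradientOn (slab (EuclideanSpace ℝ (Fin 3)) (Iio 0) isOpen_Iio) u H)
    (hgauge : ∀ a : ℝ, 0 < a →
      ENNReal.ofReal (a ^ (2 * ρ)) * cknA a (0 : ℝ × EuclideanSpace ℝ (Fin 3)) u +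
          ENNReal.ofReal (a ^ ρ) * cknE a (0 : ℝ × EuclideanSpace ℝ (Fin 3)) H +
        ENNReal.ofReal (a ^ (2 * ρ)) * cknD a (0 : ℝ × EuclideanSpace ℝ (Fin 3)) p ≤ (c₀ : ℝ≥0∞))
    (hT₁ : T₁ ≤ 0) (hT : T₁ ≤ T₀) (hcl : IsClassicalEulerSolutionOn (Iio T₁) 0 u p) (hm : 1 < m)
    (hvel : ∀ s : ℝ, s < T₁ → ∀ y, ‖u s y‖ ≤ M * (T₀ - s) ^ (-m))
    (hK : ∀ s : ℝ, s < T₁ → ∀ y, ‖fderiv ℝ (u s) y‖ ≤ K)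
    (hgrad : ∀ δ : ℝ, 0 < δ → ∃ D k : ℝ, 1 < k ∧
      ∀ s : ℝ, s < T₁ → ∀ y : EuclideanSpace ℝ (Fin 3), δ ≤ ‖y‖ → ‖fderiv ℝ (u s) y‖ ≤ D * (T₀ - s) ^ (-k)) :
    uncurry u =ᵐ[volume.restrict (Iio (0 : ℝ) ×ˢ (univ : Set (EuclideanSpace ℝ (Fin 3))))] 0 := by
  obtain ⟨s₀, hs₀⟩ := exists_lt T₁
  have hK0 : 0 ≤ K := (norm_nonneg _).trans (hK s₀ hs₀ 0)
  have hLip : ∀ s : ℝ, s < T₁ → LipschitzWith ⟨K, hK0⟩ (u s) := by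
    intro s hs
    refine lipschitzWith_of_nnnorm_fderiv_le ((hcl.contDiff_velocity hs).differentiable (by simp)) fun y => ?_
    have h : (‖fderiv ℝ (u s) y‖₊ : ℝ) ≤ K := by rw [coe_nnnorm]; exact hK s hs y
    exact_mod_cast h
  exact ae_eq_zero_of_gauge_of_fadingPowerPast hρ hρh hsw hH hgauge hT₁ hT hcl hm hvel hLip hgrad

end FadingPowerPast

namespace NegRateClock

variable {u : ℝ → EuclideanSpace ℝ (Fin 3) → EuclideanSpace ℝ (Fin 3)} {p : ℝ → EuclideanSpace ℝ (Fin 3) → ℝ}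
  {T₁ T₀ g : ℝ} {W : EuclideanSpace ℝ (Fin 3) → EuclideanSpace ℝ (Fin 3)}

/-! ### The dictionary of a power clock on a past sub-slab -/

/-- The profile in terms of one slice `τ₀ < T₁ ≤ T₀`: `W z = ((T₀−τ₀)^{g−1})⁻¹ • u(τ₀, (T₀−τ₀)^{g} z)`. [folklore] -/
theorem profile_eq (hT : T₁ ≤ T₀)
    (hW : ∀ τ : ℝ, τ < T₁ → ∀ y, u τ y = (T₀ - τ) ^ (g - 1) • W ((T₀ - τ) ^ (-g) • y)) {τ₀ : ℝ} (hτ₀ : τ₀ < T₁)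
    (z : EuclideanSpace ℝ (Fin 3)) :
    W z = ((T₀ - τ₀) ^ (g - 1))⁻¹ • u τ₀ ((T₀ - τ₀) ^ g • z) := by
  have hs : (0 : ℝ) < T₀ - τ₀ := by linarith
  have h := hW τ₀ hτ₀ ((T₀ - τ₀) ^ g • z)
  rw [smul_smul, ← Real.rpow_add hs, neg_add_cancel, Real.rpow_zero, one_smul] at h
  rw [h, smul_smul, inv_mul_cancel₀ (Real.rpow_pos_of_pos hs _).ne', one_smul]

/-- The profile of a classical power clock on a past sub-slab is `C¹`. [folklore] -/
theorem contDiff_profile (hcl : IsClassicalEulerSolutionOn (Iio T₁) 0 u p) (hT : T₁ ≤ T₀)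
    (hW : ∀ τ : ℝ, τ < T₁ → ∀ y, u τ y = (T₀ - τ) ^ (g - 1) • W ((T₀ - τ) ^ (-g) • y)) :
    ContDiff ℝ 1 W := by
  obtain ⟨τ₀, hτ₀⟩ := exists_lt T₁
  have hrep : W = fun z => ((T₀ - τ₀) ^ (g - 1))⁻¹ • u τ₀ ((T₀ - τ₀) ^ g • z) :=
    funext fun z => profile_eq hT hW hτ₀ z
  rw [hrep]
  have h1 : ContDiff ℝ 1 (u τ₀) := (hcl.contDiff_velocity hτ₀).of_le (by exact_mod_cast le_top)
  exact (h1.comp (contDiff_const_smul _)).const_smul _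

/-- **The slice gradient of a power clock**: `∇u(s, ·)(y) = (T₀−s)^{−1} • ∇W((T₀−s)^{−g} y)` for `s < T₁ ≤ T₀` (`W` differentiable). [folklore] -/
theorem hasFDerivAt_slice (hT : T₁ ≤ T₀) (hWd : Differentiable ℝ W)
    (hW : ∀ τ : ℝ, τ < T₁ → ∀ y, u τ y = (T₀ - τ) ^ (g - 1) • W ((T₀ - τ) ^ (-g) • y)) {s : ℝ} (hs : s < T₁)
    (y : EuclideanSpace ℝ (Fin 3)) :
    HasFDerivAt (u s) ((T₀ - s) ^ (-(1 : ℝ)) • fderiv ℝ W ((T₀ - s) ^ (-g) • y)) y := by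
  have hpos : (0 : ℝ) < T₀ - s := by linarith
  have hus : u s = fun y => (T₀ - s) ^ (g - 1) • W ((T₀ - s) ^ (-g) • y) := funext (hW s hs)
  rw [hus]
  have h1 : HasFDerivAt (fun y : EuclideanSpace ℝ (Fin 3) => (T₀ - s) ^ (-g) • y)
      ((T₀ - s) ^ (-g) • ContinuousLinearMap.id ℝ (EuclideanSpace ℝ (Fin 3))) y :=
    (ContinuousLinearMap.id ℝ (EuclideanSpace ℝ (Fin 3))).hasFDerivAt.const_smul ((T₀ - s) ^ (-g))
  have h2 := ((hWd ((T₀ - s) ^ (-g) • y)).hasFDerivAt.comp y h1).const_smul ((T₀ - s) ^ (g - 1))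
  refine h2.congr_fderiv (ContinuousLinearMap.ext fun v => ?_)
  simp only [FunLike.coe_smul, Pi.smul_apply, ContinuousLinearMap.comp_apply, ContinuousLinearMap.id_apply, map_smul,
    smul_smul]
  rw [← Real.rpow_add hpos, show g - 1 + -g = -(1 : ℝ) by ring]

/-- The norm of the slice gradient: `‖∇u(s, y)‖ = (T₀−s)^{−1} ‖∇W((T₀−s)^{−g} y)‖`. [folklore] -/
theorem norm_fderiv_slice (hT : T₁ ≤ T₀) (hWd : Differentiable ℝ W)
    (hW : ∀ τ : ℝ, τ < T₁ → ∀ y, u τ y = (T₀ - τ) ^ (g - 1) • W ((T₀ - τ) ^ (-g) • y)) {s : ℝ} (hs : s < T₁)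
    (y : EuclideanSpace ℝ (Fin 3)) :
    ‖fderiv ℝ (u s) y‖ = (T₀ - s) ^ (-(1 : ℝ)) * ‖fderiv ℝ W ((T₀ - s) ^ (-g) • y)‖ := by
  have hpos : (0 : ℝ) < T₀ - s := by linarith
  rw [(hasFDerivAt_slice hT hWd hW hs y).fderiv, norm_smul, Real.norm_eq_abs, abs_of_pos (Real.rpow_pos_of_pos hpos _)]

variable {C q : ℝ}

/-- The constant of a tame gradient bound `‖∇W(z)‖ ≤ C (1 + ‖z‖)^{−q}` is non-negative. [folklore] -/
theorem tame_const_nonneg (htame : ∀ z : EuclideanSpace ℝ (Fin 3), ‖fderiv ℝ W z‖ ≤ C * (1 + ‖z‖) ^ (-q)) : 0 ≤ C := by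
  have h := htame 0
  rw [norm_zero, add_zero, Real.one_rpow, mul_one] at h
  exact (norm_nonneg _).trans h

/-- **Uniform Lipschitz bound** on the shrunk sub-slab: for `s < T₁` with `T₁ + 1 ≤ T₀` (so `T₀ − s ≥ 1`), `‖∇u(s, y)‖ ≤ C`. [folklore] -/
theorem norm_fderiv_slice_le (hT : T₁ + 1 ≤ T₀) (hWd : Differentiable ℝ W)
    (hW : ∀ τ : ℝ, τ < T₁ → ∀ y, u τ y = (T₀ - τ) ^ (g - 1) • W ((T₀ - τ) ^ (-g) • y))
    (htame : ∀ z : EuclideanSpace ℝ (Fin 3), ‖fderiv ℝ W z‖ ≤ C * (1 + ‖z‖) ^ (-q)) (hq : 0 < q)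
    {s : ℝ} (hs : s < T₁) (y : EuclideanSpace ℝ (Fin 3)) : ‖fderiv ℝ (u s) y‖ ≤ C := by
  have hC0 : 0 ≤ C := tame_const_nonneg htame
  have hge1 : (1 : ℝ) ≤ T₀ - s := by linarith
  rw [norm_fderiv_slice (by linarith) hWd hW hs y]
  have h1 : (T₀ - s) ^ (-(1 : ℝ)) ≤ 1 := Real.rpow_le_one_of_one_le_of_nonpos hge1 (by norm_num)
  have h2 : ‖fderiv ℝ W ((T₀ - s) ^ (-g) • y)‖ ≤ C := by
    refine (htame _).trans ?_
    have h3 : (1 + ‖(T₀ - s) ^ (-g) • y‖) ^ (-q) ≤ 1 :=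
      Real.rpow_le_one_of_one_le_of_nonpos (by nlinarith [norm_nonneg ((T₀ - s) ^ (-g) • y)]) (by linarith)
    nlinarith
  have h4 : 0 ≤ (T₀ - s) ^ (-(1 : ℝ)) := Real.rpow_nonneg (by linarith) _
  nlinarith [norm_nonneg (fderiv ℝ W ((T₀ - s) ^ (-g) • y))]

/-- **Algebraic decay of the gradient off a ball**: for `s < T₁ ≤ T₀`, `‖y‖ ≥ δ > 0` and `g < 0`,
`‖∇u(s, y)‖ ≤ C δ^{−q} (T₀−s)^{−(1 − gq)}` (since `‖(T₀−s)^{−g} y‖ ≥ (T₀−s)^{−g} δ`). [folklore] -/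
theorem norm_fderiv_slice_le_of_le_norm (hT : T₁ ≤ T₀) (hWd : Differentiable ℝ W)
    (hW : ∀ τ : ℝ, τ < T₁ → ∀ y, u τ y = (T₀ - τ) ^ (g - 1) • W ((T₀ - τ) ^ (-g) • y))
    (htame : ∀ z : EuclideanSpace ℝ (Fin 3), ‖fderiv ℝ W z‖ ≤ C * (1 + ‖z‖) ^ (-q)) (hq : 0 < q)
    {δ : ℝ} (hδ : 0 < δ) {s : ℝ} (hs : s < T₁) {y : EuclideanSpace ℝ (Fin 3)} (hy : δ ≤ ‖y‖) :
    ‖fderiv ℝ (u s) y‖ ≤ C * δ ^ (-q) * (T₀ - s) ^ (-(1 - g * q)) := by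
  have hC0 : 0 ≤ C := tame_const_nonneg htame
  have hpos : (0 : ℝ) < T₀ - s := by linarith
  have hE : 0 < (T₀ - s) ^ (-g) := Real.rpow_pos_of_pos hpos _
  rw [norm_fderiv_slice hT hWd hW hs y]
  -- the tame bound at the rescaled point
  have hz : (T₀ - s) ^ (-g) * δ ≤ 1 + ‖(T₀ - s) ^ (-g) • y‖ := by
    rw [norm_smul, Real.norm_eq_abs, abs_of_pos hE]
    nlinarith
  have h1 : (1 + ‖(T₀ - s) ^ (-g) • y‖) ^ (-q) ≤ ((T₀ - s) ^ (-g) * δ) ^ (-q) :=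
    Real.rpow_le_rpow_of_nonpos (by positivity) hz (by linarith)
  have h2 : ((T₀ - s) ^ (-g) * δ) ^ (-q) = δ ^ (-q) * (T₀ - s) ^ (g * q) := by
    rw [Real.mul_rpow hE.le hδ.le, ← Real.rpow_mul hpos.le, mul_comm]
    congr 1
    ring_nf
  have h3 : ‖fderiv ℝ W ((T₀ - s) ^ (-g) • y)‖ ≤ C * (δ ^ (-q) * (T₀ - s) ^ (g * q)) :=
    (htame _).trans (mul_le_mul_of_nonneg_left (h1.trans h2.le) hC0)
  have h4 : 0 ≤ (T₀ - s) ^ (-(1 : ℝ)) := Real.rpow_nonneg hpos.le _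
  calc (T₀ - s) ^ (-(1 : ℝ)) * ‖fderiv ℝ W ((T₀ - s) ^ (-g) • y)‖
      ≤ (T₀ - s) ^ (-(1 : ℝ)) * (C * (δ ^ (-q) * (T₀ - s) ^ (g * q))) := mul_le_mul_of_nonneg_left h3 h4
    _ = C * δ ^ (-q) * ((T₀ - s) ^ (-(1 : ℝ)) * (T₀ - s) ^ (g * q)) := by ring
    _ = C * δ ^ (-q) * (T₀ - s) ^ (-(1 - g * q)) := by
        rw [← Real.rpow_add hpos]
        congr 1
        ring_nf

/-! ### Member level -/

/-- **NEGATIVE-RATE TAME POWER CLOCKS ARE TRIVIAL** (line `logtime-breathers`, residue T4 as left by `…PowerClockTameProfile`: «the clocks `g ≤ 0`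
about `T₀ > 0`», its tame `g < 0` part).  Crux hypotheses verbatim (`0 < ρ ≤ ½`) + `(u, p)` classical on a past sub-slab `(−∞, T₁)`, `T₁ ≤ 0`,
`T₁ ≤ T₀` + the power-clock representation `u(τ, y) = (T₀ − τ)^{g−1} W((T₀ − τ)^{−g} y)` for `τ < T₁` with a NEGATIVE rate `g < 0` + a TAME profile,
`‖W z‖ ≤ B` and `‖∇W(z)‖ ≤ C (1 + ‖z‖)^{−q}` (`q > 0`) ⇒ `u = 0` a.e. on `(−∞, 0) × ℝ³`.  Proof: on the shrunk sub-slab `(−∞, T₁ − 1)` the member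
has an algebraically fading tame past in the sense of `…FadingPowerPast` — envelope `B (T₀−s)^{−(1−g)}` with `1 − g > 1`, `C`-Lipschitz slices, and
`‖∇u(s, y)‖ ≤ C δ^{−q} (T₀−s)^{−(1−gq)}` off the `δ`-ball with `1 − gq > 1` — so `FadingPowerPast.ae_eq_zero_of_gauge_of_fadingPowerPast` applies.
(`g = 0`, the separable members, is the divergent borderline and is NOT covered.) [folklore; line card `Lines/logtime-breathers.md` T4] -/
theorem ae_eq_zero_of_gauge_of_tameNegRateClock {ρ : ℝ} (hρ : 0 < ρ) (hρh : ρ ≤ 1 / 2)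
    {H : ℝ → EuclideanSpace ℝ (Fin 3) → EuclideanSpace ℝ (Fin 3) →L[ℝ] EuclideanSpace ℝ (Fin 3)} {c₀ : ℝ≥0}
    (hsw : IsSuitableWeakSolutionOn (slab (EuclideanSpace ℝ (Fin 3)) (Iio 0) isOpen_Iio) 0 0 u p)
    (hH : HasWeakSpatialGradientOn (slab (EuclideanSpace ℝ (Fin 3)) (Iio 0) isOpen_Iio) u H)
    (hgauge : ∀ a : ℝ, 0 < a →
      ENNReal.ofReal (a ^ (2 * ρ)) * cknA a (0 : ℝ × EuclideanSpace ℝ (Fin 3)) u +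
          ENNReal.ofReal (a ^ ρ) * cknE a (0 : ℝ × EuclideanSpace ℝ (Fin 3)) H +
        ENNReal.ofReal (a ^ (2 * ρ)) * cknD a (0 : ℝ × EuclideanSpace ℝ (Fin 3)) p ≤ (c₀ : ℝ≥0∞))
    (hT₁ : T₁ ≤ 0) (hT : T₁ ≤ T₀) (hcl : IsClassicalEulerSolutionOn (Iio T₁) 0 u p) (hg : g < 0)
    (hW : ∀ τ : ℝ, τ < T₁ → ∀ y, u τ y = (T₀ - τ) ^ (g - 1) • W ((T₀ - τ) ^ (-g) • y))
    {B : ℝ} (hB : ∀ z, ‖W z‖ ≤ B)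
    (htame : ∃ C q : ℝ, 0 < q ∧ ∀ z, ‖fderiv ℝ W z‖ ≤ C * (1 + ‖z‖) ^ (-q)) :
    uncurry u =ᵐ[volume.restrict (Iio (0 : ℝ) ×ˢ (univ : Set (EuclideanSpace ℝ (Fin 3))))] 0 := by
  obtain ⟨C, q, hq, htame⟩ := htame
  have hWd : Differentiable ℝ W := (contDiff_profile hcl hT hW).differentiable one_ne_zero
  -- shrink the sub-slab so that the clock stays `≥ 1`
  set T₁' : ℝ := T₁ - 1 with hT₁'
  have hT₁'T₁ : T₁' < T₁ := by rw [hT₁']; linarith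
  have hT₁'0 : T₁' ≤ 0 := by linarith
  have hT₁'T₀ : T₁' ≤ T₀ := by linarith
  have hT₁'1 : T₁' + 1 ≤ T₀ := by linarith
  have hcl' : IsClassicalEulerSolutionOn (Iio T₁') 0 u p :=
    hcl.mono (Iio_subset_Iio hT₁'T₁.le) (uniqueDiffOn_Iio _)
  have hW' : ∀ τ : ℝ, τ < T₁' → ∀ y, u τ y = (T₀ - τ) ^ (g - 1) • W ((T₀ - τ) ^ (-g) • y) :=
    fun τ hτ y => hW τ (hτ.trans hT₁'T₁) y
  -- (H1) the algebraic velocity envelope, exponent `1 − g > 1`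
  have hm : (1 : ℝ) < 1 - g := by linarith
  have hvel : ∀ s : ℝ, s < T₁' → ∀ y, ‖u s y‖ ≤ B * (T₀ - s) ^ (-(1 - g)) := by
    intro s hs y
    have hpos : (0 : ℝ) < T₀ - s := by linarith
    rw [hW' s hs y, norm_smul, Real.norm_eq_abs, abs_of_pos (Real.rpow_pos_of_pos hpos _), mul_comm,
      show -(1 - g) = g - 1 by ring]
    exact mul_le_mul_of_nonneg_right (hB _) (Real.rpow_pos_of_pos hpos _).le
  -- (H2) uniformly Lipschitz slices
  have hK : ∀ s : ℝ, s < T₁' → ∀ y, ‖fderiv ℝ (u s) y‖ ≤ C :=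
    fun s hs y => norm_fderiv_slice_le hT₁'1 hWd hW' htame hq hs y
  -- (H3) algebraic decay of the gradient off every ball, exponent `1 − gq > 1`
  have hgrad : ∀ δ : ℝ, 0 < δ → ∃ D k : ℝ, 1 < k ∧
      ∀ s : ℝ, s < T₁' → ∀ y : EuclideanSpace ℝ (Fin 3), δ ≤ ‖y‖ → ‖fderiv ℝ (u s) y‖ ≤ D * (T₀ - s) ^ (-k) := by
    intro δ hδ
    refine ⟨C * δ ^ (-q), 1 - g * q, ?_, fun s hs y hy => norm_fderiv_slice_le_of_le_norm hT₁'T₀ hWd hW' htame hq hδ hs hy⟩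
    nlinarith [mul_pos_of_neg_of_neg hg (neg_lt_zero.2 hq)]
  exact FadingPowerPast.ae_eq_zero_of_gauge_of_fadingPowerPast_of_norm_fderiv_le hρ hρh hsw hH hgauge hT₁'0 hT₁'T₀ hcl' hm
    hvel hK hgrad

end NegRateClock

end Summit.NavierStokesRegularity.NavierStokesRegularity.Theorems.PowerGaugeEulerLiouville
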